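import Literature.NumberTheory.LFunctions.ConreyIwaniec2002Thm61Scaling
import Literature.NumberTheory.LFunctions.ConreyIwaniec2002Thm61DivisorMoments
import Literature.NumberTheory.LFunctions.ConreyIwaniec2002Thm61OffDiagSeries
import Mathlib.Analysis.Complex.ExponentialBounds
import HarnessLib

/-!
# Conrey–Iwaniec (2002), Theorem 6.1 / Corollary 6.2: the assembly (6.29)–(6.31), (6.39) (stub S2c of SKELETON P64)

B. Conrey, H. Iwaniec, Acta Arith. 103 (2002), §6 (6.13)–(6.17), (6.29)–(6.31), (6.36)–(6.40)
[held text `paper:arxiv-math_0111012`, p0015–p0016]. From the generic evaluation (6.4)–(6.12)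
(interface `Thm61Generic`, stub S2a) and the shifted-sum evaluation (6.27)–(6.28) (interface
`Thm61ShiftedSum`, stub S2b) we derive the registered statement S2 of SKELETON P64 (Theorem 6.1 in
the form (6.39) with the off-diagonal main term kept as `2T∫|a|²D(T/y)dy/y`): scale
`a ↦ a♯ = a(T/y)^{1/2}/64` (`Thm61Scaling`), take `b_n = λ(n)a♯(n)` (`|b_n| ≤ τ(n)(1+n/Y)⁻⁴`,
(6.16)), bound `G₁, G₂, Σ|b_n|` by the weighted divisor moments (`Thm61DivisorMoments`), choose
`H = ⌊H₀⌋`, `H₀ = Y^{9/8}/(T(1+B₁)^{1/2}(1+log Y))` (6.30) when `H₀ ≥ 1` (else `H = 1` with the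
crude bounds `|S*(1)| ≤ G₂/T²`, `|∫|a♯|²D| ≤ 6C₁Y³/T²`), resum `Σ_{h≤H}σ(h)∫|a♯|²L(hT/y)` into
`∫|a♯|²D(T/y)` up to the tail (`Thm61OffDiagSeries`), and use `K ≥ c₀𝟙_{[1,2]}`.

PROVED HERE: `ConreyIwaniec2002.thm61_assembly` = the registered stub S2c `stub_thm61_assembly`
of SKELETON P64 (signature verbatim; line `thm61-cm-convolution`).

## References
* [ConreyIwaniec2002] B. Conrey, H. Iwaniec, Acta Arith. 103 (2002) 259–312: §6 (6.13)–(6.17),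
  (6.29)–(6.31), Theorem 6.1 (6.36), Corollary 6.2 (6.37)–(6.40).
-/

noncomputable section

open Complex MeasureTheory Set Filter Real Finset

namespace Literature.NumberTheory.LFunctions

namespace ConreyIwaniec2002

namespace Thm61Assembly

open Thm61Scaling Thm61DivisorMoments Thm61OffDiagSeries

/-! ### Elementary facts about the parameters -/

/-- `1 + log Y ≤ (5/2) log Y` for `Y ≥ 2`. [folklore] -/
private theorem one_add_log_le {Y : ℝ} (hY : 2 ≤ Y) : 1 + Real.log Y ≤ 5 / 2 * Real.log Y := by
  have h2 : (2:ℝ) / 3 ≤ Real.log 2 := by have := Real.log_two_gt_d9; linarith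
  have hm : Real.log 2 ≤ Real.log Y := Real.log_le_log two_pos hY
  linarith

/-- `Y^{1/8} ≤ T` and `Y^{3/8} ≤ T³` from `Y ≤ T⁸` (`T ≥ 0`). [folklore] -/
private theorem rpow_eighth_le {T Y : ℝ} (hT : 0 ≤ T) (hY : 0 ≤ Y) (hYT : Y ≤ T ^ (8:ℕ)) :
    Y ^ (1 / 8 : ℝ) ≤ T ∧ Y ^ (3 / 8 : ℝ) ≤ T ^ 3 := by
  have h1 : Y ^ (1 / 8 : ℝ) ≤ (T ^ (8:ℕ)) ^ (1 / 8 : ℝ) := Real.rpow_le_rpow hY hYT (by norm_num)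
  have e1 : (T ^ (8:ℕ)) ^ (1 / 8 : ℝ) = T := by
    rw [← Real.rpow_natCast, ← Real.rpow_mul hT]; norm_num
  have h3 : Y ^ (3 / 8 : ℝ) ≤ (T ^ (8:ℕ)) ^ (3 / 8 : ℝ) := Real.rpow_le_rpow hY hYT (by norm_num)
  have e3 : (T ^ (8:ℕ)) ^ (3 / 8 : ℝ) = T ^ 3 := by
    rw [← Real.rpow_natCast, ← Real.rpow_mul hT]; norm_num
  exact ⟨e1 ▸ h1, e3 ▸ h3⟩

/-- `log(hY), log H` bookkeeping: for `1 ≤ h ≤ H ≤ Y^{9/8}`, `Y ≥ 2`: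
`0 ≤ 1 + log(hY) ≤ 3(1+log Y)` and `1 + log H ≤ 2(1+log Y)`. [folklore] -/
private theorem log_bounds {Y : ℝ} (hY : 2 ≤ Y) {H h : ℕ} (hh : 1 ≤ h) (hhH : h ≤ H)
    (hHY : (H : ℝ) ≤ Y ^ (9 / 8 : ℝ)) :
    0 ≤ 1 + Real.log ((h : ℝ) * Y) ∧ 1 + Real.log ((h : ℝ) * Y) ≤ 3 * (1 + Real.log Y) ∧
      1 + Real.log (H : ℝ) ≤ 2 * (1 + Real.log Y) := by
  have hY0 : 0 < Y := by linarith
  have hlogY : 0 ≤ Real.log Y := Real.log_nonneg (by linarith)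
  have hh0 : (1:ℝ) ≤ h := by exact_mod_cast hh
  have hH1 : (1:ℝ) ≤ H := by exact_mod_cast (le_trans hh hhH)
  have hlogH : Real.log (H : ℝ) ≤ 9 / 8 * Real.log Y := by
    calc Real.log (H : ℝ) ≤ Real.log (Y ^ (9 / 8 : ℝ)) := Real.log_le_log (by linarith) hHY
      _ = 9 / 8 * Real.log Y := by rw [Real.log_rpow hY0]
  have hlogh : Real.log (h : ℝ) ≤ 9 / 8 * Real.log Y :=
    (Real.log_le_log (by linarith) (by exact_mod_cast hhH)).trans hlogH
  have hloghY : Real.log ((h : ℝ) * Y) = Real.log h + Real.log Y :=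
    Real.log_mul (by linarith) hY0.ne'
  refine ⟨?_, ?_, ?_⟩
  · rw [hloghY]; have := Real.log_nonneg hh0; linarith
  · rw [hloghY]; linarith
  · linarith

/-! ### Abstract error-budget inequalities (pure real arithmetic)

In the following lemmas `P = Y^{15/8}`, `Q = Y^{9/8}`, `s = (1+B₁)^{1/2}`, `L = 1 + log Y`,
`X = s(1+C₁)PL⁴`, `H₀ = Q/(TsL)`; only the listed relations between them are used. -/

section Budget

variable {ca cb C1m C2m C0m C₁ B₁ T s P Q L X : ℝ}
  (hca : 0 ≤ ca) (hs1 : 1 ≤ s) (hC₁ : 0 ≤ C₁) (hL1 : 1 ≤ L) (hP0 : 0 < P) (hQ0 : 0 < Q)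
  (hT1 : 1 ≤ T) (hX : X = s * (1 + C₁) * P * L ^ 4)
include hca hs1 hC₁ hL1 hP0 hQ0 hT1 hX

omit hca hQ0 hT1 in
/-- `sPL⁴ ≤ X`, `(1+C₁)PL⁴ ≤ X`, `PL^k ≤ X` (`k ≤ 4`). [folklore] -/
private theorem le_X :
    s * P * L ^ 4 ≤ X ∧ (1 + C₁) * P * L ^ 4 ≤ X ∧ ∀ k : ℕ, k ≤ 4 → P * L ^ k ≤ X := by
  have hC10 : 1 ≤ 1 + C₁ := by linarith
  have hL4 : ∀ k : ℕ, k ≤ 4 → L ^ k ≤ L ^ 4 := fun k hk => pow_le_pow_right₀ hL1 hk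
  refine ⟨?_, ?_, fun k hk => ?_⟩
  · rw [hX]
    calc s * P * L ^ 4 = s * 1 * P * L ^ 4 := by ring
      _ ≤ s * (1 + C₁) * P * L ^ 4 := by gcongr
  · rw [hX]
    calc (1 + C₁) * P * L ^ 4 = 1 * (1 + C₁) * P * L ^ 4 := by ring
      _ ≤ s * (1 + C₁) * P * L ^ 4 := by gcongr
  · rw [hX]
    calc P * L ^ k = 1 * 1 * P * L ^ k := by ring
      _ ≤ s * (1 + C₁) * P * L ^ 4 :=
          mul_le_mul (mul_le_mul (mul_le_mul hs1 hC10 zero_le_one (by linarith)) le_rfl hP0.le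
            (by positivity)) (hL4 k hk) (by positivity) (by positivity)

omit hQ0 in
/-- (i) `ca·G₁/T ≤ ca·C1m·X`. [cite: ConreyIwaniec2002, §6 (6.17), (6.31)] -/
private theorem budget_e1 {G1 Y2 : ℝ} (hG1 : G1 ≤ C1m * Y2 * L ^ 3) (hY2P : Y2 ≤ P * T)
    (hC1m : 0 ≤ C1m) : ca * (G1 / T) ≤ ca * C1m * X := by
  have hT0 : 0 < T := by linarith
  obtain ⟨-, -, hk⟩ := le_X hs1 hC₁ hL1 hP0 hX
  have h1 : G1 / T ≤ C1m * (P * L ^ 3) := by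
    rw [div_le_iff₀ hT0]
    calc G1 ≤ C1m * Y2 * L ^ 3 := hG1
      _ ≤ C1m * (P * T) * L ^ 3 := by gcongr
      _ = C1m * (P * L ^ 3) * T := by ring
  calc ca * (G1 / T) ≤ ca * (C1m * (P * L ^ 3)) := mul_le_mul_of_nonneg_left h1 hca
    _ ≤ ca * (C1m * X) := by gcongr; exact hk 3 (by norm_num)
    _ = ca * C1m * X := by ring

omit hQ0 in
/-- (iii) `ca·S₀²/T³ ≤ ca·C0m²·X`. [cite: ConreyIwaniec2002, §6 (6.17), (6.31)] -/
private theorem budget_e3 {S0 Y : ℝ} (hS0 : S0 ≤ C0m * Y * L) (hS0n : 0 ≤ S0)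
    (hY2P : Y ^ 2 ≤ P * T) : ca * (S0 ^ 2 / T ^ 3) ≤ ca * C0m ^ 2 * X := by
  have hT0 : 0 < T := by linarith
  obtain ⟨-, -, hk⟩ := le_X hs1 hC₁ hL1 hP0 hX
  have hT3 : T ≤ T ^ 3 := by
    calc T = T ^ 1 := (pow_one T).symm
      _ ≤ T ^ 3 := pow_le_pow_right₀ hT1 (by norm_num)
  have h2 : S0 ^ 2 / T ^ 3 ≤ C0m ^ 2 * (P * L ^ 2) := by
    calc S0 ^ 2 / T ^ 3 ≤ (C0m * Y * L) ^ 2 / T := by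
          gcongr
      _ = C0m ^ 2 * Y ^ 2 * L ^ 2 / T := by ring
      _ ≤ C0m ^ 2 * (P * T) * L ^ 2 / T := by gcongr
      _ = C0m ^ 2 * (P * L ^ 2) := by field_simp
  calc ca * (S0 ^ 2 / T ^ 3) ≤ ca * (C0m ^ 2 * (P * L ^ 2)) := mul_le_mul_of_nonneg_left h2 hca
    _ ≤ ca * (C0m ^ 2 * X) := by gcongr; exact hk 2 (by norm_num)
    _ = ca * C0m ^ 2 * X := by ring

/-- (ii) `ca·G₂/(TH) ≤ 2ca·C2m·X` when `1/(TH) ≤ 2sL/Q`. [cite: ConreyIwaniec2002, §6 (6.30)–(6.31)] -/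
private theorem budget_e2 {G2 Hr : ℝ} (hG2 : G2 ≤ C2m * (P * Q) * L ^ 3)
    (hHr : 0 < Hr) (hTH : 1 / (T * Hr) ≤ 2 * s * L / Q) (hC2m : 0 ≤ C2m) :
    ca * (G2 / (T * Hr)) ≤ 2 * ca * C2m * X := by
  obtain ⟨hsX, -, -⟩ := le_X hs1 hC₁ hL1 hP0 hX
  have h1 : G2 / (T * Hr) ≤ C2m * (P * Q) * L ^ 3 * (2 * s * L / Q) := by
    rw [div_eq_mul_one_div]
    exact mul_le_mul hG2 hTH (by positivity) (by positivity)
  have h2 : C2m * (P * Q) * L ^ 3 * (2 * s * L / Q) = 2 * C2m * (s * P * L ^ 4) := by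
    field_simp
  calc ca * (G2 / (T * Hr)) ≤ ca * (2 * C2m * (s * P * L ^ 4)) := by
        rw [← h2]; exact mul_le_mul_of_nonneg_left h1 hca
    _ ≤ ca * (2 * C2m * X) := by gcongr
    _ = 2 * ca * C2m * X := by ring

omit hca in
/-- (iv) the tail `2T·2C₁Y³T⁻²(2+log H)/H ≤ 24X`. [cite: ConreyIwaniec2002, §6 (6.29)–(6.31)] -/
private theorem budget_e4 {Y3 lH Hr : ℝ} (hY3 : Y3 = P * Q) (hlH : 2 + lH ≤ 3 * L)
    (hHr : 0 < Hr) (hH' : 1 / Hr ≤ 2 * s * L * T / Q) :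
    2 * T * (2 * C₁ * Y3 / T ^ 2 * ((2 + lH) / Hr)) ≤ 24 * X := by
  have hT0 : 0 < T := by linarith
  have hC1' : C₁ ≤ 1 + C₁ := by linarith
  have h1 : (2 + lH) / Hr ≤ 3 * L * (2 * s * L * T / Q) := by
    rw [div_eq_mul_one_div]
    exact mul_le_mul hlH hH' (by positivity) (by positivity)
  have hL2 : L ^ 2 ≤ L ^ 4 := pow_le_pow_right₀ hL1 (by norm_num)
  have hY30 : 0 ≤ Y3 := by rw [hY3]; positivity
  calc 2 * T * (2 * C₁ * Y3 / T ^ 2 * ((2 + lH) / Hr))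
      ≤ 2 * T * (2 * C₁ * Y3 / T ^ 2 * (3 * L * (2 * s * L * T / Q))) := by gcongr
    _ = 24 * C₁ * (s * P * L ^ 2) := by rw [hY3]; field_simp; ring
    _ ≤ 24 * (1 + C₁) * (s * P * L ^ 4) := by gcongr
    _ = 24 * X := by rw [hX]; ring

omit hca in
/-- (v) the S2b errors: `2T·cb·[162(1+B₁)Y^{3/4}L⁵H + 4(1+C₁)Y²L²/T² + 54(1+C₁)L⁴H²/T²] ≤ 440cb·X`.
[cite: ConreyIwaniec2002, §6 (6.28)–(6.31)] -/
private theorem budget_e5 {cb Y34 Y2 Hr H₀ : ℝ} (hcb : 0 ≤ cb) (hB₁ : 0 ≤ B₁) (hs2 : s ^ 2 = 1 + B₁)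
    (hY34Q : Y34 * Q = P) (hY34 : 0 ≤ Y34) (hY2P : Y2 ≤ P * T) (hQ2 : Q ^ 2 ≤ P * T ^ 3)
    (hHr0 : 0 ≤ Hr) (hHle : Hr ≤ H₀) (hH₀ : H₀ = Q / (T * s * L)) (hH₀QT : H₀ ≤ Q / T) :
    2 * T * (cb * (162 * (1 + B₁) * Y34 * L ^ 5 * Hr + 4 * (1 + C₁) * Y2 * L ^ 2 / T ^ 2 +
      54 * (1 + C₁) * L ^ 4 * Hr ^ 2 / T ^ 2)) ≤ 440 * cb * X := by
  have hT0 : 0 < T := by linarith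
  have hs0 : 0 < s := by linarith
  have hL0 : 0 < L := by linarith
  obtain ⟨hsX, hcX, hk⟩ := le_X hs1 hC₁ hL1 hP0 hX
  have hL2 : L ^ 2 ≤ L ^ 4 := pow_le_pow_right₀ hL1 (by norm_num)
  have hv1 : 2 * T * (162 * (1 + B₁) * Y34 * L ^ 5 * Hr) ≤ 324 * (s * P * L ^ 4) := by
    calc 2 * T * (162 * (1 + B₁) * Y34 * L ^ 5 * Hr)
        ≤ 2 * T * (162 * (1 + B₁) * Y34 * L ^ 5 * H₀) := by gcongr
      _ = 324 * ((1 + B₁) / s) * (Y34 * Q) * L ^ 4 := by rw [hH₀]; field_simp; ring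
      _ = 324 * (s * P * L ^ 4) := by rw [hY34Q, ← hs2]; field_simp
  have hv2 : 2 * T * (4 * (1 + C₁) * Y2 * L ^ 2 / T ^ 2) ≤ 8 * ((1 + C₁) * P * L ^ 4) := by
    calc 2 * T * (4 * (1 + C₁) * Y2 * L ^ 2 / T ^ 2) = 8 * (1 + C₁) * (Y2 / T) * L ^ 2 := by
          field_simp; ring
      _ ≤ 8 * (1 + C₁) * P * L ^ 4 := by
          gcongr
          rw [div_le_iff₀ hT0]; exact hY2P
      _ = 8 * ((1 + C₁) * P * L ^ 4) := by ring
  have hv3 : 2 * T * (54 * (1 + C₁) * L ^ 4 * Hr ^ 2 / T ^ 2) ≤ 108 * ((1 + C₁) * P * L ^ 4) := by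
    have hH2 : Hr ^ 2 ≤ Q ^ 2 / T ^ 2 := by
      rw [← div_pow]; exact pow_le_pow_left₀ hHr0 (hHle.trans hH₀QT) 2
    calc 2 * T * (54 * (1 + C₁) * L ^ 4 * Hr ^ 2 / T ^ 2)
        ≤ 2 * T * (54 * (1 + C₁) * L ^ 4 * (Q ^ 2 / T ^ 2) / T ^ 2) := by gcongr
      _ = 108 * (1 + C₁) * L ^ 4 * (Q ^ 2 / T ^ 3) := by field_simp; ring
      _ ≤ 108 * (1 + C₁) * L ^ 4 * P := by
          gcongr; rw [div_le_iff₀ (by positivity)]; exact hQ2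
      _ = 108 * ((1 + C₁) * P * L ^ 4) := by ring
  have e : 2 * T * (cb * (162 * (1 + B₁) * Y34 * L ^ 5 * Hr + 4 * (1 + C₁) * Y2 * L ^ 2 / T ^ 2 +
      54 * (1 + C₁) * L ^ 4 * Hr ^ 2 / T ^ 2)) =
      cb * (2 * T * (162 * (1 + B₁) * Y34 * L ^ 5 * Hr) + 2 * T * (4 * (1 + C₁) * Y2 * L ^ 2 / T ^ 2) +
        2 * T * (54 * (1 + C₁) * L ^ 4 * Hr ^ 2 / T ^ 2)) := by ring
  rw [e]
  calc cb * (2 * T * (162 * (1 + B₁) * Y34 * L ^ 5 * Hr) + 2 * T * (4 * (1 + C₁) * Y2 * L ^ 2 / T ^ 2) +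
        2 * T * (54 * (1 + C₁) * L ^ 4 * Hr ^ 2 / T ^ 2))
      ≤ cb * (324 * (s * P * L ^ 4) + 8 * ((1 + C₁) * P * L ^ 4) + 108 * ((1 + C₁) * P * L ^ 4)) := by
        gcongr
    _ ≤ cb * (324 * X + 8 * X + 108 * X) := by gcongr
    _ = 440 * cb * X := by ring

/-- (ii') `(ca+2)·G₂/T ≤ (ca+2)·C2m·X` when `Q/T ≤ sL`. [cite: ConreyIwaniec2002, §6 (6.31)] -/
private theorem budget_e2' {G2 : ℝ} (hG2 : G2 ≤ C2m * (P * Q) * L ^ 3) (hQT : Q / T ≤ s * L)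
    (hC2m : 0 ≤ C2m) : (ca + 2) * (G2 / T) ≤ (ca + 2) * C2m * X := by
  have hT0 : 0 < T := by linarith
  obtain ⟨hsX, -, -⟩ := le_X hs1 hC₁ hL1 hP0 hX
  have h1 : G2 / T ≤ C2m * (s * P * L ^ 4) := by
    calc G2 / T ≤ C2m * (P * Q) * L ^ 3 / T := by gcongr
      _ = C2m * P * L ^ 3 * (Q / T) := by field_simp
      _ ≤ C2m * P * L ^ 3 * (s * L) := by gcongr
      _ = C2m * (s * P * L ^ 4) := by ring
  calc (ca + 2) * (G2 / T) ≤ (ca + 2) * (C2m * (s * P * L ^ 4)) := mul_le_mul_of_nonneg_left h1 (by positivity)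
    _ ≤ (ca + 2) * (C2m * X) := by gcongr
    _ = (ca + 2) * C2m * X := by ring

omit hca in
/-- (ix) `2T·6C₁Y³/T² ≤ 12X` when `Q/T ≤ sL`. [cite: ConreyIwaniec2002, §6 (6.29)–(6.31)] -/
private theorem budget_e9 {Y3 : ℝ} (hY3 : Y3 = P * Q) (hQT : Q / T ≤ s * L) :
    2 * T * (6 * C₁ * Y3 / T ^ 2) ≤ 12 * X := by
  have hT0 : 0 < T := by linarith
  have hL4 : L ^ 1 ≤ L ^ 4 := pow_le_pow_right₀ hL1 (by norm_num)
  have hC1' : C₁ ≤ 1 + C₁ := by linarith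
  calc 2 * T * (6 * C₁ * Y3 / T ^ 2) = 12 * C₁ * P * (Q / T) := by rw [hY3]; field_simp; ring
    _ ≤ 12 * (1 + C₁) * P * (s * L) := by gcongr
    _ = 12 * ((1 + C₁) * s * P * L ^ 1) := by ring
    _ ≤ 12 * ((1 + C₁) * s * P * L ^ 4) := by gcongr
    _ = 12 * X := by rw [hX]; ring

end Budget

/-! ### The divisor sums of (6.28)–(6.30) and the real parts of the shifted sums -/

/-- `Σ_{h≤H} τ(h)·R(h) ≤ 162(1+B₁)Y^{3/4}L⁵H + 4(1+C₁)Y²L²/T² + 54(1+C₁)L⁴H²/T²` (`L = 1+log Y`,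
`H ≤ Y^{9/8}`), from `Σ_{h≤H}τ(h) ≤ H(1+log H)` and `Σ_{h≤H}τ(h)/h ≤ (1+log H)²`.
[cite: ConreyIwaniec2002, §6 (6.28)–(6.30)] -/
theorem sum_card_divisors_R_le {B₁ C₁ T Y : ℝ} (hB₁ : 0 ≤ B₁) (hC₁ : 0 ≤ C₁) (hT : 0 < T)
    (hY : 2 ≤ Y) {H : ℕ} (hH : 1 ≤ H) (hHY : (H : ℝ) ≤ Y ^ (9 / 8 : ℝ)) :
    ∑ h ∈ Finset.Icc 1 H, ((Nat.divisors h).card : ℝ) *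
        ((1 + B₁) * Y ^ (3 / 4 : ℝ) * (1 + Real.log (h * Y)) ^ 4 +
          (1 + C₁) * (Y ^ 2 / (T ^ 2 * h) + h * (1 + Real.log (h * Y)) ^ 3 / T ^ 2)) ≤
      162 * (1 + B₁) * Y ^ (3 / 4 : ℝ) * (1 + Real.log Y) ^ 5 * H +
        4 * (1 + C₁) * Y ^ 2 * (1 + Real.log Y) ^ 2 / T ^ 2 +
        54 * (1 + C₁) * (1 + Real.log Y) ^ 4 * (H : ℝ) ^ 2 / T ^ 2 := by
  set L : ℝ := 1 + Real.log Y with hL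
  have hY0 : 0 < Y := by linarith
  have hL0 : 0 < L := by have := Real.log_nonneg (by linarith : (1:ℝ) ≤ Y); rw [hL]; linarith
  have h27 : 0 ≤ (1 + C₁) * (27 * L ^ 3 / T ^ 2) :=
    mul_nonneg (by linarith) (div_nonneg (mul_nonneg (by norm_num) (pow_nonneg hL0.le 3)) (sq_nonneg T))
  have hHpos : (0 : ℝ) < H := by exact_mod_cast hH
  have hpt : ∀ h ∈ Finset.Icc 1 H, ((Nat.divisors h).card : ℝ) *
      ((1 + B₁) * Y ^ (3 / 4 : ℝ) * (1 + Real.log (h * Y)) ^ 4 +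
        (1 + C₁) * (Y ^ 2 / (T ^ 2 * h) + h * (1 + Real.log (h * Y)) ^ 3 / T ^ 2)) ≤
      (1 + B₁) * Y ^ (3 / 4 : ℝ) * (81 * L ^ 4) * (Nat.divisors h).card +
        (1 + C₁) * (Y ^ 2 / T ^ 2) * ((Nat.divisors h).card * (h : ℝ)⁻¹) +
        (1 + C₁) * (27 * L ^ 3 / T ^ 2) * ((H : ℝ) * (Nat.divisors h).card) := by
    intro h hh
    rw [Finset.mem_Icc] at hh
    obtain ⟨hl0, hl3, -⟩ := log_bounds hY hh.1 hh.2 hHY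
    have hh0 : (0 : ℝ) < h := by exact_mod_cast hh.1
    have hhH : (h : ℝ) ≤ H := by exact_mod_cast hh.2
    have hτ : (0 : ℝ) ≤ (Nat.divisors h).card := Nat.cast_nonneg _
    have h4 : (1 + Real.log (h * Y)) ^ 4 ≤ 81 * L ^ 4 := by
      calc (1 + Real.log (h * Y)) ^ 4 ≤ (3 * L) ^ 4 := pow_le_pow_left₀ hl0 hl3 4
        _ = 81 * L ^ 4 := by ring
    have h3 : (1 + Real.log (h * Y)) ^ 3 ≤ 27 * L ^ 3 := by
      calc (1 + Real.log (h * Y)) ^ 3 ≤ (3 * L) ^ 3 := pow_le_pow_left₀ hl0 hl3 3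
        _ = 27 * L ^ 3 := by ring
    have hR' : (1 + B₁) * Y ^ (3 / 4 : ℝ) * (1 + Real.log (h * Y)) ^ 4 +
        (1 + C₁) * (Y ^ 2 / (T ^ 2 * h) + h * (1 + Real.log (h * Y)) ^ 3 / T ^ 2) ≤
        (1 + B₁) * Y ^ (3 / 4 : ℝ) * (81 * L ^ 4) +
        (1 + C₁) * (Y ^ 2 / (T ^ 2 * h) + h * (27 * L ^ 3) / T ^ 2) := by gcongr
    calc ((Nat.divisors h).card : ℝ) * ((1 + B₁) * Y ^ (3 / 4 : ℝ) * (1 + Real.log (h * Y)) ^ 4 +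
          (1 + C₁) * (Y ^ 2 / (T ^ 2 * h) + h * (1 + Real.log (h * Y)) ^ 3 / T ^ 2))
        ≤ (Nat.divisors h).card * ((1 + B₁) * Y ^ (3 / 4 : ℝ) * (81 * L ^ 4) +
            (1 + C₁) * (Y ^ 2 / (T ^ 2 * h) + h * (27 * L ^ 3) / T ^ 2)) :=
          mul_le_mul_of_nonneg_left hR' hτ
      _ = (1 + B₁) * Y ^ (3 / 4 : ℝ) * (81 * L ^ 4) * (Nat.divisors h).card +
            (1 + C₁) * (Y ^ 2 / T ^ 2) * ((Nat.divisors h).card * (h : ℝ)⁻¹) +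
            (1 + C₁) * (27 * L ^ 3 / T ^ 2) * ((h : ℝ) * (Nat.divisors h).card) := by
          field_simp
          ring
      _ ≤ _ := by gcongr
  refine (Finset.sum_le_sum hpt).trans ?_
  rw [Finset.sum_add_distrib, Finset.sum_add_distrib, ← Finset.mul_sum, ← Finset.mul_sum,
    ← Finset.mul_sum, ← Finset.mul_sum]
  have hs1' := Literature.NumberTheory.DiophantineGeometry.SquarefulCount.sum_card_divisors_le H
  have hs2' := Literature.NumberTheory.DiophantineGeometry.SquarefulCount.sum_card_divisors_div_le H
  obtain ⟨-, -, hlH⟩ := log_bounds hY hH le_rfl hHY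
  have hlH0 : 0 ≤ 1 + Real.log (H : ℝ) := by
    have := Real.log_nonneg (show (1:ℝ) ≤ H by exact_mod_cast hH); linarith
  have hA1 : ∑ h ∈ Finset.Icc 1 H, ((Nat.divisors h).card : ℝ) ≤ 2 * L * H := by
    calc ∑ h ∈ Finset.Icc 1 H, ((Nat.divisors h).card : ℝ) ≤ H * (1 + Real.log H) := hs1'
      _ ≤ H * (2 * L) := by gcongr
      _ = 2 * L * H := by ring
  have hA2 : ∑ h ∈ Finset.Icc 1 H, ((Nat.divisors h).card : ℝ) * (h : ℝ)⁻¹ ≤ 4 * L ^ 2 := by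
    calc ∑ h ∈ Finset.Icc 1 H, ((Nat.divisors h).card : ℝ) * (h : ℝ)⁻¹ ≤ (1 + Real.log H) ^ 2 := hs2'
      _ ≤ (2 * L) ^ 2 := pow_le_pow_left₀ hlH0 hlH 2
      _ = 4 * L ^ 2 := by ring
  have hA3 : (H : ℝ) * ∑ h ∈ Finset.Icc 1 H, ((Nat.divisors h).card : ℝ) ≤ 2 * L * (H : ℝ) ^ 2 := by
    calc (H : ℝ) * ∑ h ∈ Finset.Icc 1 H, ((Nat.divisors h).card : ℝ) ≤ H * (2 * L * H) :=
          mul_le_mul_of_nonneg_left hA1 hHpos.le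
      _ = 2 * L * (H : ℝ) ^ 2 := by ring
  calc (1 + B₁) * Y ^ (3 / 4 : ℝ) * (81 * L ^ 4) * ∑ h ∈ Finset.Icc 1 H, ((Nat.divisors h).card : ℝ) +
        (1 + C₁) * (Y ^ 2 / T ^ 2) * ∑ h ∈ Finset.Icc 1 H, ((Nat.divisors h).card : ℝ) * (h : ℝ)⁻¹ +
        (1 + C₁) * (27 * L ^ 3 / T ^ 2) * ((H : ℝ) * ∑ h ∈ Finset.Icc 1 H, ((Nat.divisors h).card : ℝ))
      ≤ (1 + B₁) * Y ^ (3 / 4 : ℝ) * (81 * L ^ 4) * (2 * L * H) +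
        (1 + C₁) * (Y ^ 2 / T ^ 2) * (4 * L ^ 2) +
        (1 + C₁) * (27 * L ^ 3 / T ^ 2) * (2 * L * (H : ℝ) ^ 2) := by gcongr
    _ = _ := by ring

/-- Abstract assembly of case `H₀ ≥ 1`. [folklore] -/
private theorem case1_core {Ab L0TGb T ReS Ih MD' tail divsum cb E B123 B4 B5 CX : ℝ}
    (hA : Ab - L0TGb - 2 * T * ReS ≤ E) (hre : ReS ≤ Ih + cb * divsum) (hfin : Ih ≤ MD' + tail)
    (h2T : 0 ≤ 2 * T) (hE : E ≤ B123) (htail : 2 * T * tail ≤ B4)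
    (hdivB : 2 * T * (cb * divsum) ≤ B5) (hsum : B123 + B4 + B5 ≤ CX) :
    Ab ≤ L0TGb + 2 * T * MD' + CX := by
  have h1 := mul_le_mul_of_nonneg_left hre h2T
  have h2 := mul_le_mul_of_nonneg_left hfin h2T
  have e1 : 2 * T * (Ih + cb * divsum) = 2 * T * Ih + 2 * T * (cb * divsum) := by ring
  have e2 : 2 * T * (MD' + tail) = 2 * T * MD' + 2 * T * tail := by ring
  linarith

/-- Abstract assembly of case `H₀ < 1`. [folklore] -/
private theorem case2_core {Ab L0TGb T ReS G2T2 MD' D6 E1 E2 E3 B1 B2 B3 B9 CX : ℝ}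
    (hA : Ab - L0TGb - 2 * T * ReS ≤ E1 + E2 + E3) (hS1 : ReS ≤ G2T2) (hMD : -MD' ≤ D6)
    (h2T : 0 ≤ 2 * T) (hE1 : E1 ≤ B1) (hE2 : 2 * T * G2T2 + E2 ≤ B2) (hE3 : E3 ≤ B3)
    (h9 : 2 * T * D6 ≤ B9) (hsum : B1 + B2 + B3 + B9 ≤ CX) :
    Ab ≤ L0TGb + 2 * T * MD' + CX := by
  have h1 := mul_le_mul_of_nonneg_left hS1 h2T
  have h2 := mul_le_mul_of_nonneg_left hMD h2T
  have e2 : 2 * T * -MD' = -(2 * T * MD') := by ring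
  linarith

/-- `2T·(G/T²) + ca·(G/T) = (ca+2)·(G/T)`. [folklore] -/
private theorem e22_abs {T ca G : ℝ} (hT : T ≠ 0) :
    2 * T * (G / T ^ 2) + ca * (G / T) = (ca + 2) * (G / T) := by
  field_simp
  ring

/-- The real parts of the shifted sums: for `b_n = λ(n)a♯(n)`,
`Re Σ_{h≤H} S*_b(h) ≤ Σ_{h≤H} σ(h)∫|a♯|²L(hT/y)dy + cb·Σ_{h≤H}τ(h)R(h)` by (6.27)–(6.28).
[cite: ConreyIwaniec2002, §6 (6.27)–(6.29)] -/
theorem re_sum_shifted_le {cb : ℝ} (h2b : Thm61ShiftedSum cb) {K : ℝ → ℝ} (hK : IsCIKernel K)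
    {lam : ℕ → ℂ} {σ : ℕ → ℝ} {B₁ C₁ : ℝ} (hB₁ : 0 ≤ B₁) (hC₁ : 0 ≤ C₁)
    (hlam : ∀ n : ℕ, 1 ≤ n → ‖lam n‖ ≤ (Nat.divisors n).card)
    (hσ : ∀ h : ℕ, 1 ≤ h → |σ h| ≤ C₁ * ∑ d ∈ Nat.divisors h, (d : ℝ)⁻¹)
    (hSCB : ShiftedConvolutionBound lam σ B₁) {T Y : ℝ} {a : ℝ → ℂ} (hT : 2 ≤ T) (hTY : T ≤ Y)
    (ha : IsCutoff a T Y) {b : ℕ → ℂ} (hb : b = fun n => lam n * sharp a T n) (H : ℕ) :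
    (∑ h ∈ Finset.Icc 1 H, ∑' n : ℕ, b (n + h) * starRingEnd ℂ (b n) * (ciL K (h * T / n) : ℂ)).re ≤
      (∑ h ∈ Finset.Icc 1 H, σ h * ∫ y in Ioi (0:ℝ), ‖sharp a T y‖ ^ 2 * ciL K ((h : ℝ) * T / y)) +
        cb * ∑ h ∈ Finset.Icc 1 H, ((Nat.divisors h).card : ℝ) *
          ((1 + B₁) * Y ^ (3 / 4 : ℝ) * (1 + Real.log (h * Y)) ^ 4 +
            (1 + C₁) * (Y ^ 2 / (T ^ 2 * h) + h * (1 + Real.log (h * Y)) ^ 3 / T ^ 2)) := by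
  have hT1 : 1 ≤ T := by linarith
  have hY2 : 2 ≤ Y := le_trans hT hTY
  have hash14 : IsCutoff14 (sharp a T) Y := isCutoff14_sharp hT hTY ha
  have hash0 : sharp a T 0 = 0 := sharp_zero a T
  rw [Complex.re_sum, Finset.mul_sum, ← Finset.sum_add_distrib]
  refine Finset.sum_le_sum fun h hh => ?_
  have hh1 : 1 ≤ h := (Finset.mem_Icc.mp hh).1
  have hB := h2b K hK lam σ B₁ C₁ hB₁ hC₁ hlam hσ hSCB T Y (sharp a T) hT1 hY2 hash14 hash0 h hh1
  have hSS : (∑' n : ℕ, b (n + h) * starRingEnd ℂ (b n) * (ciL K (h * T / n) : ℂ)) =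
      ∑' n : ℕ, lam (n + h) * sharp a T ((n : ℝ) + h) * starRingEnd ℂ (lam n * sharp a T n) *
        (ciL K (h * T / n) : ℂ) := by
    refine tsum_congr fun n => ?_
    simp only [hb, Nat.cast_add]
  rw [hSS]
  set S : ℂ := ∑' n : ℕ, lam (n + h) * sharp a T ((n : ℝ) + h) * starRingEnd ℂ (lam n * sharp a T n) *
    (ciL K (h * T / n) : ℂ) with hSdef
  set M : ℂ := (σ h : ℂ) * ((∫ y in Ioi (0:ℝ), ‖sharp a T y‖ ^ 2 * ciL K (h * T / y) : ℝ) : ℂ)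
    with hMdef
  have hBM : ‖S - M‖ ≤ cb * (Nat.divisors h).card *
      ((1 + B₁) * Y ^ (3 / 4 : ℝ) * (1 + Real.log (h * Y)) ^ 4 +
        (1 + C₁) * (Y ^ 2 / (T ^ 2 * h) + h * (1 + Real.log (h * Y)) ^ 3 / T ^ 2)) := hB
  have hMre : M.re = σ h * ∫ y in Ioi (0:ℝ), ‖sharp a T y‖ ^ 2 * ciL K ((h : ℝ) * T / y) := by
    simp only [hMdef, ← Complex.ofReal_mul, Complex.ofReal_re]
  calc S.re = M.re + (S - M).re := by simp
    _ ≤ M.re + ‖S - M‖ := by gcongr; exact Complex.re_le_norm _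
    _ ≤ _ := by rw [hMre]; linarith

section Cases

variable {ca cb : ℝ} (hca : 0 < ca) (hcb : 0 < cb) (h2a : Thm61Generic ca) (h2b : Thm61ShiftedSum cb)
  {K : ℝ → ℝ} (hK : IsCIKernel K) {lam : ℕ → ℂ} {σ : ℕ → ℝ} {B₁ C₁ : ℝ} (hB₁ : 0 ≤ B₁) (hC₁ : 0 ≤ C₁)
  (hlam : ∀ n : ℕ, 1 ≤ n → ‖lam n‖ ≤ (Nat.divisors n).card)
  (hσ : ∀ h : ℕ, 1 ≤ h → |σ h| ≤ C₁ * ∑ d ∈ Nat.divisors h, (d : ℝ)⁻¹)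
  (hSCB : ShiftedConvolutionBound lam σ B₁) {T Y : ℝ} {a : ℝ → ℂ} (hT : 2 ≤ T) (hTY : T ≤ Y)
  (ha : IsCutoff a T Y) {b : ℕ → ℂ} (hb : b = fun n => lam n * sharp a T n)
  {C1m C2m C0m s P Q L X MD' H₀ : ℝ} (hC1m : 0 ≤ C1m) (hC2m : 0 ≤ C2m)
  (hs1 : 1 ≤ s) (hs2 : s ^ 2 = 1 + B₁) (hL : L = 1 + Real.log Y) (hP0 : 0 < P)
  (hQ : Q = Y ^ (9 / 8 : ℝ)) (hX : X = s * (1 + C₁) * P * L ^ 4) (hY3PQ : Y ^ 3 = P * Q)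
  (hY34Q : Y ^ (3 / 4 : ℝ) * Q = P) (hY2P : Y ^ 2 ≤ P * T) (hQ2 : Q ^ 2 ≤ P * T ^ 3)
  (hG2s : Summable fun n : ℕ => (n : ℝ) ^ 2 * ‖b n‖ ^ 2)
  (hG1 : ∑' n : ℕ, (n : ℝ) * ‖b n‖ ^ 2 ≤ C1m * Y ^ 2 * L ^ 3)
  (hG2 : ∑' n : ℕ, (n : ℝ) ^ 2 * ‖b n‖ ^ 2 ≤ C2m * Y ^ 3 * L ^ 3)
  (hS0 : ∑' n : ℕ, ‖b n‖ ≤ C0m * Y * L)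
  (hMsharp : ∫ y in Ioi (0:ℝ), ‖sharp a T y‖ ^ 2 * ciD K σ (T / y) = MD')
  (hH₀ : H₀ = Q / (T * s * L))
include hca hcb h2a h2b hK hB₁ hC₁ hlam hσ hSCB hT hTY ha hb hC1m hC2m hs1 hs2 hL hP0 hQ hX hY3PQ
  hY34Q hY2P hQ2 hG2s hG1 hG2 hS0 hMsharp hH₀

/-- **Case `H₀ ≥ 1` of the assembly** ((6.29)–(6.31) with `H = ⌊H₀⌋`): for `b_n = λ(n)a♯(n)`,
`𝒜_b ≤ L(0)TG_b + 2T∫|a♯|²D(T/y)dy + (ca(C₁ₘ+2C₂ₘ+C₀ₘ²) + 440cb + 24)·X`.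
[cite: ConreyIwaniec2002, §6 (6.29)–(6.31)] -/
theorem case1_bound (hcase : 1 ≤ H₀) :
    ∫ t : ℝ, K (t / T) * ‖LSeries b (t * I)‖ ^ 2 ≤
      ciL K 0 * T * (∑' n : ℕ, ‖b n‖ ^ 2) + 2 * T * MD' +
        (ca * C1m + 2 * ca * C2m + ca * C0m ^ 2 + 24 + 440 * cb) * X := by
  have hT0 : 0 < T := by linarith
  have hT1 : 1 ≤ T := by linarith
  have hY2 : 2 ≤ Y := le_trans hT hTY
  have hY0 : 0 < Y := by linarith
  have hL1 : 1 ≤ L := by rw [hL]; have := Real.log_nonneg (by linarith : (1:ℝ) ≤ Y); linarith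
  have hL0 : 0 < L := by linarith
  have hs0 : 0 < s := by linarith
  have hQ0 : 0 < Q := by rw [hQ]; exact Real.rpow_pos_of_pos hY0 _
  have hb0 : b 0 = 0 := by simp [hb, sharp_zero]
  have hash14 : IsCutoff14 (sharp a T) Y := isCutoff14_sharp hT hTY ha
  have hg : ∀ y : ℝ, 0 < y → ‖sharp a T y‖ ≤ ((1 + y / Y) ^ 4)⁻¹ := fun y hy =>
    norm_le_of_isCutoff14 hash14 hy
  have hgc : ContinuousOn (sharp a T) (Ioi 0) := hash14.1.continuousOn
  have hG2n : 0 ≤ ∑' n : ℕ, (n : ℝ) ^ 2 * ‖b n‖ ^ 2 := tsum_nonneg fun n => by positivity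
  have hS0n : 0 ≤ ∑' n : ℕ, ‖b n‖ := tsum_nonneg fun n => norm_nonneg _
  have hH₀0 : 0 < H₀ := by rw [hH₀]; positivity
  have hTsL : 1 ≤ T * s * L :=
    one_le_mul_of_one_le_of_one_le (one_le_mul_of_one_le_of_one_le hT1 hs1) hL1
  have hTsL0 : 0 < T * s * L := by positivity
  have eQ : Q = H₀ * (T * s * L) := by rw [hH₀]; field_simp
  have hH₀Q : H₀ ≤ Q := by rw [hH₀]; exact div_le_self hQ0.le hTsL
  have hH₀QT : H₀ ≤ Q / T := by
    rw [hH₀]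
    refine div_le_div_of_nonneg_left hQ0.le hT0 ?_
    calc T = T * 1 * 1 := by ring
      _ ≤ T * s * L := by gcongr
  have hG2' : ∑' n : ℕ, (n : ℝ) ^ 2 * ‖b n‖ ^ 2 ≤ C2m * (P * Q) * L ^ 3 := by rw [← hY3PQ]; exact hG2
  have he1 := budget_e1 hca.le hs1 hC₁ hL1 hP0 hT1 hX hG1 hY2P hC1m
  have he3 := budget_e3 hca.le hs1 hC₁ hL1 hP0 hT1 hX hS0 hS0n hY2P
  have h2T : 0 ≤ 2 * T := by linarith
  set H : ℕ := ⌊H₀⌋₊ with hHdef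
  have hH1 : 1 ≤ H := Nat.one_le_floor_iff _ |>.mpr hcase
  have hHle : (H : ℝ) ≤ H₀ := Nat.floor_le hH₀0.le
  have hHlt : H₀ < (H : ℝ) + 1 := Nat.lt_floor_add_one H₀
  have hHpos : (0 : ℝ) < H := by exact_mod_cast hH1
  have hHhalf : H₀ ≤ 2 * (H : ℝ) := by
    have : (1 : ℝ) ≤ H := by exact_mod_cast hH1
    linarith
  have hHY : (H : ℝ) ≤ Y ^ (9 / 8 : ℝ) := hQ ▸ hHle.trans hH₀Q
  have hTH : 1 / (T * (H : ℝ)) ≤ 2 * s * L / Q := by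
    rw [div_le_div_iff₀ (by positivity) hQ0, one_mul, eQ]
    calc H₀ * (T * s * L) ≤ 2 * (H : ℝ) * (T * s * L) := mul_le_mul_of_nonneg_right hHhalf hTsL0.le
      _ = 2 * s * L * (T * H) := by ring
  have hH' : 1 / (H : ℝ) ≤ 2 * s * L * T / Q := by
    rw [div_le_div_iff₀ hHpos hQ0, one_mul, eQ]
    calc H₀ * (T * s * L) ≤ 2 * (H : ℝ) * (T * s * L) := mul_le_mul_of_nonneg_right hHhalf hTsL0.le
      _ = 2 * s * L * T * H := by ring
  obtain ⟨-, -, hlH⟩ := log_bounds hY2 hH1 le_rfl hHY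
  have hlH' : 2 + Real.log (H : ℝ) ≤ 3 * L := by rw [hL]; linarith
  -- S2a
  have hA := (le_abs_self _).trans (h2a K hK b hb0 hG2s T hT0 H hH1)
  -- S2b (real parts)
  have hre := re_sum_shifted_le h2b hK hB₁ hC₁ hlam hσ hSCB hT hTY ha hb H
  -- truncation of the `σ`-series
  obtain ⟨_, hsplit, htail⟩ := tsum_sigma_integral_split hK hC₁ hσ hY2 hg hgc hT0 hH1
  have htot := tsum_sigma_integral_eq hK hC₁ hσ hY2 hg hgc hT0
  have hfin : ∑ h ∈ Finset.Icc 1 H, σ h * ∫ y in Ioi (0:ℝ), ‖sharp a T y‖ ^ 2 * ciL K ((h : ℝ) * T / y) ≤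
      MD' + 2 * C₁ * Y ^ 3 / T ^ 2 * ((2 + Real.log H) / H) := by
    have e : ∑ h ∈ Finset.Icc 1 H, σ h * ∫ y in Ioi (0:ℝ), ‖sharp a T y‖ ^ 2 * ciL K ((h : ℝ) * T / y) =
        MD' - ∑' i : ℕ, σ (i + H + 1) *
          ∫ y in Ioi (0:ℝ), ‖sharp a T y‖ ^ 2 * ciL K (((i + H + 1 : ℕ) : ℝ) * T / y) := by
      rw [← hMsharp, ← htot, hsplit]; ring
    rw [e]
    have := neg_abs_le (∑' i : ℕ, σ (i + H + 1) *
      ∫ y in Ioi (0:ℝ), ‖sharp a T y‖ ^ 2 * ciL K (((i + H + 1 : ℕ) : ℝ) * T / y))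
    linarith
  -- divisor sums and the budget
  have hdiv := sum_card_divisors_R_le hB₁ hC₁ hT0 hY2 hH1 hHY
  rw [← hL] at hdiv
  have he2 := budget_e2 hca.le hs1 hC₁ hL1 hP0 hQ0 hT1 hX hG2' hHpos hTH hC2m
  have he4 := budget_e4 hs1 hC₁ hL1 hP0 hQ0 hT1 hX (C₁ := C₁) hY3PQ hlH' hHpos hH'
  have he5 := budget_e5 hs1 hC₁ hL1 hP0 hQ0 hT1 hX hcb.le hB₁ hs2 hY34Q
    (Real.rpow_nonneg hY0.le _) hY2P hQ2 hHpos.le hHle hH₀ hH₀QT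
  have hE : ca * ((∑' n : ℕ, (n : ℝ) * ‖b n‖ ^ 2) / T +
      (∑' n : ℕ, (n : ℝ) ^ 2 * ‖b n‖ ^ 2) / (T * H) + (∑' n : ℕ, ‖b n‖) ^ 2 / T ^ 3) ≤
      ca * C1m * X + 2 * ca * C2m * X + ca * C0m ^ 2 * X := by
    rw [mul_add, mul_add]; exact add_le_add (add_le_add he1 he2) he3
  have hdivB := le_trans (mul_le_mul_of_nonneg_left (mul_le_mul_of_nonneg_left hdiv hcb.le) h2T) he5
  exact case1_core hA hre hfin h2T hE he4 hdivB (le_of_eq (by ring))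

omit hcb h2b hB₁ hlam hSCB hs2 hY34Q hQ2 in
/-- **Case `H₀ < 1` of the assembly** (`H = 1`, crude bounds `|S*(1)| ≤ G₂/T²`,
`|∫|a♯|²D| ≤ 6C₁Y³/T²`): `𝒜_b ≤ L(0)TG_b + 2T∫|a♯|²D(T/y)dy + (ca(C₁ₘ+C₂ₘ+C₀ₘ²) + 2C₂ₘ + 12)·X`.
[cite: ConreyIwaniec2002, §6 (6.29)–(6.31)] -/
theorem case2_bound (hcase : H₀ < 1) :
    ∫ t : ℝ, K (t / T) * ‖LSeries b (t * I)‖ ^ 2 ≤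
      ciL K 0 * T * (∑' n : ℕ, ‖b n‖ ^ 2) + 2 * T * MD' +
        (ca * C1m + (ca + 2) * C2m + ca * C0m ^ 2 + 12) * X := by
  have hT0 : 0 < T := by linarith
  have hT1 : 1 ≤ T := by linarith
  have hY2 : 2 ≤ Y := le_trans hT hTY
  have hY0 : 0 < Y := by linarith
  have hL1 : 1 ≤ L := by rw [hL]; have := Real.log_nonneg (by linarith : (1:ℝ) ≤ Y); linarith
  have hL0 : 0 < L := by linarith
  have hs0 : 0 < s := by linarith
  have hQ0 : 0 < Q := by rw [hQ]; exact Real.rpow_pos_of_pos hY0 _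
  have hb0 : b 0 = 0 := by simp [hb, sharp_zero]
  have hash14 : IsCutoff14 (sharp a T) Y := isCutoff14_sharp hT hTY ha
  have hg : ∀ y : ℝ, 0 < y → ‖sharp a T y‖ ≤ ((1 + y / Y) ^ 4)⁻¹ := fun y hy =>
    norm_le_of_isCutoff14 hash14 hy
  have hgc : ContinuousOn (sharp a T) (Ioi 0) := hash14.1.continuousOn
  have hS0n : 0 ≤ ∑' n : ℕ, ‖b n‖ := tsum_nonneg fun n => norm_nonneg _
  have hH₀0 : 0 < H₀ := by rw [hH₀]; positivity
  have hTsL0 : 0 < T * s * L := by positivity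
  have eQ : Q = H₀ * (T * s * L) := by rw [hH₀]; field_simp
  have hG2' : ∑' n : ℕ, (n : ℝ) ^ 2 * ‖b n‖ ^ 2 ≤ C2m * (P * Q) * L ^ 3 := by rw [← hY3PQ]; exact hG2
  have he1 := budget_e1 hca.le hs1 hC₁ hL1 hP0 hT1 hX hG1 hY2P hC1m
  have he3 := budget_e3 hca.le hs1 hC₁ hL1 hP0 hT1 hX hS0 hS0n hY2P
  have h2T : 0 ≤ 2 * T := by linarith
  have hQT : Q / T ≤ s * L := by
    rw [div_le_iff₀ hT0, eQ]
    calc H₀ * (T * s * L) ≤ 1 * (T * s * L) := mul_le_mul_of_nonneg_right hcase.le hTsL0.le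
      _ = s * L * T := by ring
  -- S2a with `H = 1`
  have hA := (le_abs_self _).trans (h2a K hK b hb0 hG2s T hT0 1 le_rfl)
  simp only [Nat.cast_one, mul_one, Finset.Icc_self, Finset.sum_singleton, one_mul] at hA
  -- `Re S*(1) ≤ G₂/T²`
  have hS1 : (∑' n : ℕ, b (n + 1) * starRingEnd ℂ (b n) * (ciL K (T / n) : ℂ)).re ≤
      (∑' n : ℕ, (n : ℝ) ^ 2 * ‖b n‖ ^ 2) / T ^ 2 :=
    (Complex.re_le_norm _).trans (norm_shiftedSum_one_le hK hb0 hG2s hT0)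
  -- the crude `D`-bound
  have hMD' : |MD'| ≤ 6 * C₁ * Y ^ 3 / T ^ 2 := by
    rw [← hMsharp]; exact abs_integral_normSq_ciD_le hK hC₁ hσ hY2 hg hgc hT0
  have hMDle : -MD' ≤ 6 * C₁ * Y ^ 3 / T ^ 2 := (neg_le_abs _).trans hMD'
  have he2' := budget_e2' hca.le hs1 hC₁ hL1 hP0 hQ0 hT1 hX hG2' hQT hC2m
  have he9 := budget_e9 hs1 hC₁ hL1 hP0 hQ0 hT1 hX (C₁ := C₁) hY3PQ hQT
  have hE2 : 2 * T * ((∑' n : ℕ, (n : ℝ) ^ 2 * ‖b n‖ ^ 2) / T ^ 2) +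
      ca * ((∑' n : ℕ, (n : ℝ) ^ 2 * ‖b n‖ ^ 2) / T) ≤ (ca + 2) * C2m * X := by
    rw [e22_abs hT0.ne']; exact he2'
  have hA2 : (∫ t : ℝ, K (t / T) * ‖LSeries b (t * I)‖ ^ 2) - ciL K 0 * T * (∑' n : ℕ, ‖b n‖ ^ 2) -
      2 * T * (∑' n : ℕ, b (n + 1) * starRingEnd ℂ (b n) * (ciL K (T / n) : ℂ)).re ≤
      ca * ((∑' n : ℕ, (n : ℝ) * ‖b n‖ ^ 2) / T) + ca * ((∑' n : ℕ, (n : ℝ) ^ 2 * ‖b n‖ ^ 2) / T) +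
        ca * ((∑' n : ℕ, ‖b n‖) ^ 2 / T ^ 3) := by
    rw [← mul_add, ← mul_add]; exact hA
  exact case2_core hA2 hS1 hMDle h2T he1 hE2 he3 he9 (le_of_eq (by ring))

end Cases

end Thm61Assembly

open Thm61Assembly Thm61Scaling Thm61DivisorMoments Thm61OffDiagSeries in
/-- **Conrey–Iwaniec (2002), Theorem 6.1 with Corollary 6.2's normalisation — the assembly of
(6.29)–(6.31), (6.39) from the generic evaluation (6.4)–(6.12) and the shifted-sum evaluation
(6.27)–(6.28)** (= registered stub S2c `stub_thm61_assembly` of SKELETON P64, verbatim).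
[cite: ConreyIwaniec2002, §6 (6.29)–(6.31), Theorem 6.1 (6.36), Corollary 6.2 (6.39)] -/
theorem thm61_assembly :
    ∀ (ca cb : ℝ), 0 < ca → 0 < cb → Thm61Generic ca → Thm61ShiftedSum cb →
    ∃ c : ℝ, 0 < c ∧
      ∀ (K : ℝ → ℝ) (c₀ : ℝ), IsCIKernel K → (∀ u, 0 ≤ K u) → 0 < c₀ →
        (∀ u ∈ Set.Icc (1 : ℝ) 2, c₀ ≤ K u) →
          ∀ (lam : ℕ → ℂ) (σ : ℕ → ℝ) (B₁ C₁ : ℝ), 0 ≤ B₁ → 0 ≤ C₁ →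
            (∀ n : ℕ, 1 ≤ n → ‖lam n‖ ≤ (Nat.divisors n).card) →
              (∀ h : ℕ, 1 ≤ h → |σ h| ≤ C₁ * ∑ d ∈ Nat.divisors h, (d : ℝ)⁻¹) →
                ShiftedConvolutionBound lam σ B₁ →
                  ∀ (T Y : ℝ) (a : ℝ → ℂ), 2 ≤ T → T ≤ Y → Y ≤ T ^ (8 : ℕ) → IsCutoff a T Y →
                    c₀ * ∫ t in T..2 * T, ‖LSeries (fun n ↦ a n * lam n) (1 / 2 + t * I)‖ ^ 2 ≤
                      ciL K 0 * T * (∑' n : ℕ, ‖a n * lam n‖ ^ 2 / (n : ℝ)) +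
                        2 * T * (∫ y in Set.Ioi (0 : ℝ), ‖a y‖ ^ 2 * ciD K σ (T / y) / y) +
                        c * (1 + B₁) ^ (1 / 2 : ℝ) * (1 + C₁) * T⁻¹ * Y ^ (15 / 8 : ℝ) *
                          Real.log Y ^ 4 := by
  intro ca cb hca hcb h2a h2b
  obtain ⟨C1m, hC1m, hM1⟩ := divisorSq_moment_le (k := 1) (by norm_num)
  obtain ⟨C2m, hC2m, hM2⟩ := divisorSq_moment_le (k := 2) (by norm_num)
  obtain ⟨C0m, hC0m, hM0⟩ := divisor_moment_le
  set Cbig : ℝ := ca * (C1m + 3 * C2m + C0m ^ 2) + 500 * cb + 2 * C2m + 40 with hCbig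
  have hCbig0 : 0 < Cbig := by positivity
  refine ⟨64 ^ 2 * Cbig * (5 / 2) ^ 4, by positivity, ?_⟩
  intro K c₀ hK hK0 hc₀ hKc lam σ B₁ C₁ hB₁ hC₁ hlam hσ hSCB T Y a hT hTY hYT ha
  -- ### parameters
  have hT0 : 0 < T := by linarith
  have hT1 : 1 ≤ T := by linarith
  have hY2 : 2 ≤ Y := le_trans hT hTY
  have hY0 : 0 < Y := by linarith
  have hY1 : 1 ≤ Y := by linarith
  have hlogY : 0 < Real.log Y := Real.log_pos (by linarith)
  set L : ℝ := 1 + Real.log Y with hL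
  have hL1 : 1 ≤ L := by rw [hL]; linarith
  have hL0 : 0 < L := by linarith
  set s : ℝ := (1 + B₁) ^ (1 / 2 : ℝ) with hs
  have hs1 : 1 ≤ s := Real.one_le_rpow (by linarith) (by norm_num)
  have hs0 : 0 < s := by linarith
  have hs2 : s ^ 2 = 1 + B₁ := by
    rw [hs, ← Real.rpow_natCast, ← Real.rpow_mul (by linarith)]; norm_num
  set P : ℝ := Y ^ (15 / 8 : ℝ) with hP
  set Q : ℝ := Y ^ (9 / 8 : ℝ) with hQ
  have hP0 : 0 < P := Real.rpow_pos_of_pos hY0 _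
  have hQ0 : 0 < Q := Real.rpow_pos_of_pos hY0 _
  have hQ1 : 1 ≤ Q := Real.one_le_rpow hY1 (by norm_num)
  have hY3PQ : (Y ^ 3 : ℝ) = P * Q := by
    rw [hP, hQ, ← Real.rpow_add hY0]; norm_num
  have hY34Q : Y ^ (3 / 4 : ℝ) * Q = P := by rw [hQ, hP, ← Real.rpow_add hY0]; norm_num
  obtain ⟨hY18, hY38⟩ := rpow_eighth_le hT0.le hY0.le hYT
  have hY2P : (Y ^ 2 : ℝ) ≤ P * T := by
    have e : (Y ^ 2 : ℝ) = P * Y ^ (1 / 8 : ℝ) := by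
      rw [hP, ← Real.rpow_add hY0]; norm_num
    rw [e]; exact mul_le_mul_of_nonneg_left hY18 hP0.le
  have hQ2 : Q ^ 2 ≤ P * T ^ 3 := by
    have e : Q ^ 2 = P * Y ^ (3 / 8 : ℝ) := by
      rw [hQ, hP, ← Real.rpow_natCast, ← Real.rpow_mul hY0.le, ← Real.rpow_add hY0]; norm_num
    rw [e]; exact mul_le_mul_of_nonneg_left hY38 hP0.le
  have hC1' : C₁ ≤ 1 + C₁ := by linarith
  have hC10 : 1 ≤ 1 + C₁ := by linarith
  set X : ℝ := s * (1 + C₁) * P * L ^ 4 with hX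
  have hX0 : 0 < X := by positivity
  -- useful comparisons with `X`
  have hm1 : 1 ≤ s * (1 + C₁) * L ^ 4 :=
    one_le_mul_of_one_le_of_one_le (one_le_mul_of_one_le_of_one_le hs1 hC10) (one_le_pow₀ hL1)
  have hPX : P ≤ X := by
    calc P ≤ P * (s * (1 + C₁) * L ^ 4) := le_mul_of_one_le_right hP0.le hm1
      _ = X := by rw [hX]; ring
  have hL4 : ∀ k : ℕ, k ≤ 4 → L ^ k ≤ L ^ 4 := fun k hk => pow_le_pow_right₀ hL1 hk
  -- ### the scaled cutoff `a♯` and the sequence `b`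
  set b : ℕ → ℂ := fun n => lam n * sharp a T n with hb
  have hb0 : b 0 = 0 := by simp [hb, sharp_zero]
  have hbn : ∀ n : ℕ, ‖b n‖ ≤ (n.divisors.card : ℝ) * ((1 + (n : ℝ) / Y) ^ 4)⁻¹ := by
    intro n
    rcases Nat.eq_zero_or_pos n with rfl | hn
    · simp [hb0]
    · exact norm_b_le hT hTY ha hlam hn
  have hbn2 : ∀ n : ℕ, ‖b n‖ ^ 2 ≤ ((1 + (n : ℝ) / Y) ^ 8)⁻¹ * (n.divisors.card : ℝ) ^ 2 := by
    intro n
    calc ‖b n‖ ^ 2 ≤ ((n.divisors.card : ℝ) * ((1 + (n : ℝ) / Y) ^ 4)⁻¹) ^ 2 :=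
          pow_le_pow_left₀ (norm_nonneg _) (hbn n) 2
      _ = ((1 + (n : ℝ) / Y) ^ 8)⁻¹ * (n.divisors.card : ℝ) ^ 2 := by
          have e : ((((1 + (n : ℝ) / Y) ^ 4)⁻¹) ^ 2 : ℝ) = ((1 + (n : ℝ) / Y) ^ 8)⁻¹ := by
            rw [inv_pow, ← pow_mul]
          rw [mul_pow, e, mul_comm]
  -- ### moments of `b`
  obtain ⟨hs1m, hle1m⟩ := hM1 Y hY2
  obtain ⟨hs2m, hle2m⟩ := hM2 Y hY2
  obtain ⟨hs0m, hle0m⟩ := hM0 Y hY2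
  have hG1s : Summable fun n : ℕ => (n : ℝ) * ‖b n‖ ^ 2 := by
    refine Summable.of_nonneg_of_le (fun n => by positivity) (fun n => ?_) hs1m
    rw [pow_one, mul_assoc]; exact mul_le_mul_of_nonneg_left (hbn2 n) (Nat.cast_nonneg n)
  have hG1 : ∑' n : ℕ, (n : ℝ) * ‖b n‖ ^ 2 ≤ C1m * Y ^ 2 * L ^ 3 := by
    calc ∑' n : ℕ, (n : ℝ) * ‖b n‖ ^ 2
        ≤ ∑' n : ℕ, (n : ℝ) ^ 1 * ((1 + (n : ℝ) / Y) ^ 8)⁻¹ * (n.divisors.card : ℝ) ^ 2 := by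
          refine hG1s.tsum_le_tsum (fun n => ?_) hs1m
          rw [pow_one, mul_assoc]; exact mul_le_mul_of_nonneg_left (hbn2 n) (Nat.cast_nonneg n)
      _ ≤ C1m * Y ^ (1 + 1) * (1 + Real.log Y) ^ 3 := hle1m
      _ = C1m * Y ^ 2 * L ^ 3 := by rw [hL]
  have hG2s : Summable fun n : ℕ => (n : ℝ) ^ 2 * ‖b n‖ ^ 2 := by
    refine Summable.of_nonneg_of_le (fun n => by positivity) (fun n => ?_) hs2m
    rw [mul_assoc]; exact mul_le_mul_of_nonneg_left (hbn2 n) (by positivity)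
  have hG2 : ∑' n : ℕ, (n : ℝ) ^ 2 * ‖b n‖ ^ 2 ≤ C2m * Y ^ 3 * L ^ 3 := by
    calc ∑' n : ℕ, (n : ℝ) ^ 2 * ‖b n‖ ^ 2
        ≤ ∑' n : ℕ, (n : ℝ) ^ 2 * ((1 + (n : ℝ) / Y) ^ 8)⁻¹ * (n.divisors.card : ℝ) ^ 2 := by
          refine hG2s.tsum_le_tsum (fun n => ?_) hs2m
          rw [mul_assoc]; exact mul_le_mul_of_nonneg_left (hbn2 n) (by positivity)
      _ ≤ C2m * Y ^ (2 + 1) * (1 + Real.log Y) ^ 3 := hle2m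
      _ = C2m * Y ^ 3 * L ^ 3 := by rw [hL]
  have hS0s : Summable fun n : ℕ => ‖b n‖ := by
    refine Summable.of_nonneg_of_le (fun n => norm_nonneg _) (fun n => ?_) hs0m
    rw [mul_comm]; exact hbn n
  have hS0 : ∑' n : ℕ, ‖b n‖ ≤ C0m * Y * L := by
    calc ∑' n : ℕ, ‖b n‖ ≤ ∑' n : ℕ, ((1 + (n : ℝ) / Y) ^ 4)⁻¹ * (n.divisors.card : ℝ) :=
          hS0s.tsum_le_tsum (fun n => by rw [mul_comm]; exact hbn n) hs0m
      _ ≤ C0m * Y * (1 + Real.log Y) := hle0m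
      _ = C0m * Y * L := by rw [hL]
  have hG1n : 0 ≤ ∑' n : ℕ, (n : ℝ) * ‖b n‖ ^ 2 := tsum_nonneg fun n => by positivity
  have hG2n : 0 ≤ ∑' n : ℕ, (n : ℝ) ^ 2 * ‖b n‖ ^ 2 := tsum_nonneg fun n => by positivity
  have hS0n : 0 ≤ ∑' n : ℕ, ‖b n‖ := tsum_nonneg fun n => norm_nonneg _
  -- ### the three normalised quantities
  set F : ℝ → ℝ := fun t => ‖LSeries (fun n ↦ a n * lam n) (1 / 2 + t * I)‖ ^ 2 with hF
  set Ab : ℝ := ∫ t : ℝ, K (t / T) * ‖LSeries b (t * I)‖ ^ 2 with hAb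
  have hAb_eq : Ab = T / 64 ^ 2 * ∫ t : ℝ, K (t / T) * F t := by
    rw [hAb, ← integral_const_mul]
    refine integral_congr_ae (Eventually.of_forall fun t => ?_)
    simp only [hF, hb]
    rw [norm_sq_LSeries_b_eq hT0.le lam t]; ring
  set G : ℝ := ∑' n : ℕ, ‖a n * lam n‖ ^ 2 / (n : ℝ) with hGdef
  have hGb : ∑' n : ℕ, ‖b n‖ ^ 2 = T / 64 ^ 2 * G := tsum_norm_sq_b_eq hT0.le lam
  set MD : ℝ := ∫ y in Ioi (0:ℝ), ‖a y‖ ^ 2 * ciD K σ (T / y) / y with hMD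
  have hMsharp : ∫ y in Ioi (0:ℝ), ‖sharp a T y‖ ^ 2 * ciD K σ (T / y) = T / 64 ^ 2 * MD := by
    rw [hMD, ← integral_const_mul]
    refine setIntegral_congr_fun measurableSet_Ioi fun y hy => ?_
    have hy' : (0:ℝ) < y := hy
    rw [norm_sq_sharp hT0.le hy']
    field_simp
  -- ### the kernel lower bound `c₀∫_T^{2T} F ≤ ∫ K(t/T)F = (64²/T)·Ab`
  have hsumF : Summable fun n : ℕ => ‖a n * lam n‖ * (n : ℝ) ^ (-(1 / 2 : ℝ)) := by
    refine Summable.of_nonneg_of_le (fun n => by positivity) (fun n => ?_) hs0m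
    rcases Nat.eq_zero_or_pos n with rfl | hn
    · simp
    have hn0 : (0:ℝ) < n := by exact_mod_cast hn
    have ha' := (norm_le_of_isCutoff ha hT0.le hY0 hn0).2
    have h1 : (n : ℝ) ^ (-(1 / 2 : ℝ)) ≤ 1 :=
      Real.rpow_le_one_of_one_le_of_nonpos (by exact_mod_cast hn) (by norm_num)
    rw [norm_mul]
    calc ‖a n‖ * ‖lam n‖ * (n : ℝ) ^ (-(1 / 2 : ℝ)) ≤ ((1 + (n : ℝ) / Y) ^ 4)⁻¹ * (n.divisors.card : ℝ) * 1 := by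
          refine mul_le_mul (mul_le_mul ha' (hlam n hn) (norm_nonneg _) (by positivity)) h1
            (by positivity) (by positivity)
      _ = ((1 + (n : ℝ) / Y) ^ 4)⁻¹ * (n.divisors.card : ℝ) := mul_one _
  have hFc : Continuous F := by
    simp only [hF]; exact (continuous_LSeries_half_line hsumF).norm.pow 2
  have hF0 : ∀ t, 0 ≤ F t := fun t => by positivity
  have hKFi : Integrable fun t : ℝ => K (t / T) * F t := by
    have hKc : Continuous fun t : ℝ => K (t / T) := hK.1.comp (continuous_id.div_const T)
    have hKs : HasCompactSupport fun t : ℝ => K (t / T) := by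
      have h := hK.2.2.2.1.comp_smul (inv_ne_zero hT0.ne')
      have e : (fun t : ℝ => K (t / T)) = fun x : ℝ => K (T⁻¹ • x) := by
        funext x; simp [smul_eq_mul, div_eq_inv_mul]
      rw [e]; exact h
    exact (hKc.mul hFc).integrable_of_hasCompactSupport hKs.mul_right
  have hlow : c₀ * ∫ t in T..2 * T, F t ≤ ∫ t : ℝ, K (t / T) * F t :=
    kernel_lower_bound hK0 hKc hT0 hF0 hKFi (hFc.intervalIntegrable _ _)
  have hKF_eq : ∫ t : ℝ, K (t / T) * F t = 64 ^ 2 / T * Ab := by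
    rw [hAb_eq]; field_simp
  -- ### Step A: the generic evaluation (S2a) and the error budget `Err ≤ Cbig·X`
  -- We show: `Ab ≤ L(0)·T·G_b + 2T·(T/64²)·MD + Cbig·X`.
  have hmain : Ab ≤ ciL K 0 * T * (T / 64 ^ 2 * G) + 2 * T * (T / 64 ^ 2 * MD) + Cbig * X := by
    rw [← hGb, hAb]
    have hQdef : Q = Y ^ (9 / 8 : ℝ) := rfl
    by_cases hcase : 1 ≤ Q / (T * s * L)
    · have h := case1_bound hca hcb h2a h2b hK hB₁ hC₁ hlam hσ hSCB hT hTY ha hb hC1m.le hC2m.le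
        hs1 hs2 hL hP0 hQdef hX hY3PQ hY34Q hY2P hQ2 hG2s hG1 hG2 hS0 hMsharp rfl hcase
      have hc : (ca * C1m + 2 * ca * C2m + ca * C0m ^ 2 + 24 + 440 * cb) * X ≤ Cbig * X := by
        refine mul_le_mul_of_nonneg_right ?_ hX0.le
        rw [hCbig]; have := mul_nonneg hca.le hC2m.le; linarith
      linarith
    · push Not at hcase
      have h := case2_bound hca h2a hK hC₁ hσ hT hTY ha hb hC1m.le hC2m.le
        hs1 hL hP0 hQdef hX hY3PQ hY2P hG2s hG1 hG2 hS0 hMsharp rfl hcase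
      have hc : (ca * C1m + (ca + 2) * C2m + ca * C0m ^ 2 + 12) * X ≤ Cbig * X := by
        refine mul_le_mul_of_nonneg_right ?_ hX0.le
        rw [hCbig]; have := mul_nonneg hca.le hC2m.le; linarith
      linarith
  -- ### Step B: undo the normalisation
  have hlogL : L ^ 4 ≤ (5 / 2) ^ 4 * Real.log Y ^ 4 := by
    rw [← mul_pow]; exact pow_le_pow_left₀ hL0.le (one_add_log_le hY2) 4
  calc c₀ * ∫ t in T..2 * T, F t ≤ ∫ t : ℝ, K (t / T) * F t := hlow
    _ = 64 ^ 2 / T * Ab := hKF_eq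
    _ ≤ 64 ^ 2 / T * (ciL K 0 * T * (T / 64 ^ 2 * G) + 2 * T * (T / 64 ^ 2 * MD) + Cbig * X) :=
        mul_le_mul_of_nonneg_left hmain (by positivity)
    _ = ciL K 0 * T * G + 2 * T * MD + 64 ^ 2 * Cbig * (s * (1 + C₁) * T⁻¹ * P * L ^ 4) := by
        rw [hX]; field_simp
    _ ≤ ciL K 0 * T * G + 2 * T * MD +
          64 ^ 2 * Cbig * (s * (1 + C₁) * T⁻¹ * P * ((5 / 2) ^ 4 * Real.log Y ^ 4)) := by
        gcongr
    _ = ciL K 0 * T * G + 2 * T * MD +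
          64 ^ 2 * Cbig * (5 / 2) ^ 4 * (1 + B₁) ^ (1 / 2 : ℝ) * (1 + C₁) * T⁻¹ * Y ^ (15 / 8 : ℝ) *
            Real.log Y ^ 4 := by rw [hs, hP]; ring

end ConreyIwaniec2002

end Literature.NumberTheory.LFunctions

end
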